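import Literature.MeasureTheory.Group.QuotientOrbitalIntegralProperSmooth   -- ★ the non-parametric engine, `descConj`, `continuous_quotient_liftOn'_of_forall_mul_mem`
import HarnessLib

/-!
# Uniform properness modulo `M` ⇒ the quotient orbital integral of a SMOOTH FAMILY of test functions is `C^∞` jointly in (chart point, parameter) «(HYP-PARAM)»

Generic measure-theory support file (THEOREMS ONLY; no `def`, no instance, no `sorry`), namespace `Literature.MeasureTheory.Group`; the PARAMETRIC twin of ★
`Literature.MeasureTheory.Group.contDiffOn_integral_descConj_of_uniformlyProper` (`QuotientOrbitalIntegralProperSmooth.lean`).  Cell `pub/hodgecm-mathlib`, crux H413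
(`stmt-HodgeConjecture-24833`), line LH3 letter L1 clause (I₂): LH3-plan (g3) RULING #12 asks the engine E3 and the places-induction of the (I₂) road to be stated with «the test
function allowed to depend smoothly on a finite-dimensional parameter»; this is that engine, dealt once, generically (LH3-plan word 2026-09-02 «= (HYP-PARAM)»).  Count-neutral.

THE MATHEMATICS.  `G` a topological group, `M ≤ G`, `c : V → G` a chart of elements commuting with `M` on a finite-dimensional real `V`, `S ⊆ V` open with the uniform
properness (HYP) of `(x, yM) ↦ y · c(x) · y⁻¹` on compacts of `S`; `Z` a finite-dimensional real parameter space, `T ⊆ Z` open, and `a : Z → (G → F)` a family of test functions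
vanishing off ONE compact `C ⊆ G` for `z ∈ T`, factoring smoothly: `a z (y · c(x) · y⁻¹) = Ψ (p y, (x, z))` with `p : G → P` continuous and `M`-right-invariant and
`Ψ : P × (V × Z) → F` of class `C^∞`.  Then `(x, z) ↦ ∫_{G ⧸ M} a z (y · c(x) · y⁻¹) dμ(yM)` is `C^∞` on `S ×ˢ T` for every measure `μ` on `G ⧸ M` finite on compacts: near
`(x₀, z₀)` take a compact neighbourhood `K ⊆ S` of `x₀`; by (HYP) the integrands for `(x, z) ∈ K × T` are supported in ONE compact `𝒦 ⊆ G ⧸ M`, and the tree's Hörmander engine ★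
`Literature.Analysis.Calculus.contDiffAt_integral_comp_of_contDiff_of_support` (parameter space `V × Z`) differentiates under the integral sign — the proof of the ★ engine
verbatim with `V ↦ V × Z`.
* `contDiffOn_integral_descConj_of_uniformlyProper_param_local` — `Z`-local form (`z ∈ T` open);
* `contDiffOn_integral_descConj_of_uniformlyProper_param` — `T = univ`;
* `contDiff_integral_descConj_of_uniformlyProper_param` — (HYP) on all of `V`: `C^∞` on `V × Z`;
* `contDiffOn_integral_descConj_param_of_uniformlyProper` — smoothness in the parameter `z ∈ T` alone at a fixed chart point `x ∈ S`;
* `contDiffOn_integral_descConj_of_uniformlyProper_of_param` — sanity rider: the non-parametric ★ engine is the constant-family case.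
HONEST LABEL: HC_CM is proved only modulo the printed citations (2 remaining named inputs: hLiu418 = `stmt-HodgeConjecture-24832`, h413 = `stmt-HodgeConjecture-24833`) until
rung 0 closes; count-neutral.

## References
* [HormanderALPDO1] L. Hörmander, *The Analysis of Linear Partial Differential Operators I*, 2nd ed. (1990), §1.1 Thm. 1.1.9 (p. 12) and (1.1.2)″–Thm. 1.1.6 (p. 8) (differentiation in a parameter).
* [DeitmarEchterhoff2014] A. Deitmar, S. Echterhoff, *Principles of Harmonic Analysis*, 2nd ed. (2014), Lemma 9.3.3.
* [Varadarajan1989] V. S. Varadarajan, *An Introduction to Harmonic Analysis on Semisimple Lie Groups* (1989), §2.4 Thm. 8.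
-/

set_option autoImplicit false

noncomputable section

open MeasureTheory MeasureTheory.Measure Set Topology Filter
open scoped ContDiff

namespace Literature.MeasureTheory.Group

section SmoothParam

variable {G : Type*} [Group G] [TopologicalSpace G]
  {V : Type*} [NormedAddCommGroup V] [NormedSpace ℝ V] [FiniteDimensional ℝ V]
  {Z : Type*} [NormedAddCommGroup Z] [NormedSpace ℝ Z] [FiniteDimensional ℝ Z]
  {P : Type*} [NormedAddCommGroup P] [NormedSpace ℝ P]
  {F : Type*} [NormedAddCommGroup F] [NormedSpace ℝ F] [CompleteSpace F]

/-- **(HYP-PARAM), `Z`-local form.** Uniform properness modulo `M` on compacts of an open `S ⊆ V`, a family of test functions `a : Z → G → F` vanishing off one compact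
`C ⊆ G` for parameters `z` in an open `T ⊆ Z`, and a smooth factorisation `a z (y · c x · y⁻¹) = Ψ (p y, (x, z))` through a continuous `M`-right-invariant datum `p` ⇒ the
quotient orbital integral `(x, z) ↦ ∫_{G ⧸ M} a z (y · c x · y⁻¹) dμ` is `ContDiffOn ℝ ∞` on `S ×ˢ T`, for every `μ` finite on compacts.
[cite: HormanderALPDO1, §1.1 Thm. 1.1.9 (p. 12)] [cite: DeitmarEchterhoff2014, Lemma 9.3.3] [cite: Varadarajan1989, §2.4 Thm. 8] -/
theorem contDiffOn_integral_descConj_of_uniformlyProper_param_local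
    (M : Subgroup G) {c : V → G} (hcomm : ∀ x, ∀ m ∈ M, m * c x = c x * m)
    {S : Set V} (hS : IsOpen S)
    (hprop : ∀ K ⊆ S, IsCompact K → ∀ C : Set G, IsCompact C →
      ∃ 𝒦 : Set (G ⧸ M), IsCompact 𝒦 ∧ ∀ x ∈ K, ∀ y : G, y * c x * y⁻¹ ∈ C → (QuotientGroup.mk y : G ⧸ M) ∈ 𝒦)
    [MeasurableSpace (G ⧸ M)] [OpensMeasurableSpace (G ⧸ M)] [T2Space (G ⧸ M)]
    (μ : Measure (G ⧸ M)) [IsFiniteMeasureOnCompacts μ]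
    {T : Set Z} (hT : IsOpen T) {a : Z → G → F} {C : Set G} (hC : IsCompact C) (haC : ∀ z ∈ T, ∀ g ∉ C, a z g = 0)
    (p : G → P) (hp : Continuous p) (hpM : ∀ y, ∀ m ∈ M, p (y * m) = p y)
    (Ψ : P × (V × Z) → F) (hΨ : ContDiff ℝ ∞ Ψ) (hfac : ∀ z y x, a z (y * c x * y⁻¹) = Ψ (p y, (x, z))) :
    ContDiffOn ℝ ∞ (fun q : V × Z => ∫ u, descConj (c q.1) M (hcomm q.1) (a q.2) u ∂μ) (S ×ˢ T) := by
  obtain ⟨pbar, hpbar, hpbar_mk⟩ := continuous_quotient_liftOn'_of_forall_mul_mem M p hp hpM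
  -- the integrand, read through the factorisation
  have hint : ∀ q : V × Z, (fun u => descConj (c q.1) M (hcomm q.1) (a q.2) u) = fun u => Ψ (pbar u, q) := by
    rintro ⟨x, z⟩
    funext u
    induction u using QuotientGroup.induction_on with
    | H y => rw [descConj_mk, hfac, hpbar_mk]
  have hEq : (fun q : V × Z => ∫ u, descConj (c q.1) M (hcomm q.1) (a q.2) u ∂μ) = fun q => ∫ u, Ψ (pbar u, q) ∂μ := by
    funext q
    rw [hint q]
  rw [hEq]
  rintro ⟨x₀, z₀⟩ hq₀
  rw [mem_prod] at hq₀
  obtain ⟨K, hKnhds, hKsub, hK⟩ := local_compact_nhds (hS.mem_nhds hq₀.1)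
  obtain ⟨𝒦, h𝒦, hmem⟩ := hprop K hKsub hK C hC
  have hU : K ×ˢ T ∈ 𝓝 (x₀, z₀) := prod_mem_nhds hKnhds (hT.mem_nhds hq₀.2)
  have h0 : ∀ u ∉ 𝒦, ∀ q ∈ K ×ˢ T, Ψ (pbar u, q) = 0 := by
    rintro u hu ⟨x, z⟩ hq
    rw [mem_prod] at hq
    induction u using QuotientGroup.induction_on with
    | H y =>
      rw [hpbar_mk, ← hfac]
      by_contra hne
      have hgC : y * c x * y⁻¹ ∈ C := by
        by_contra hgC
        exact hne (haC z hq.2 _ hgC)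
      exact hu (hmem x hq.1 y hgC)
  exact (Literature.Analysis.Calculus.contDiffAt_integral_comp_of_contDiff_of_support μ Ψ hΨ pbar hpbar (x₀, z₀) h𝒦 hU h0).contDiffWithinAt

/-- **(HYP-PARAM)**, global parameter: the family vanishes off one compact `C` for every `z` ⇒ the quotient orbital integral is `ContDiffOn ℝ ∞` on `S ×ˢ univ`.
[cite: HormanderALPDO1, §1.1 Thm. 1.1.9 (p. 12)] [cite: DeitmarEchterhoff2014, Lemma 9.3.3] -/
theorem contDiffOn_integral_descConj_of_uniformlyProper_param
    (M : Subgroup G) {c : V → G} (hcomm : ∀ x, ∀ m ∈ M, m * c x = c x * m)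
    {S : Set V} (hS : IsOpen S)
    (hprop : ∀ K ⊆ S, IsCompact K → ∀ C : Set G, IsCompact C →
      ∃ 𝒦 : Set (G ⧸ M), IsCompact 𝒦 ∧ ∀ x ∈ K, ∀ y : G, y * c x * y⁻¹ ∈ C → (QuotientGroup.mk y : G ⧸ M) ∈ 𝒦)
    [MeasurableSpace (G ⧸ M)] [OpensMeasurableSpace (G ⧸ M)] [T2Space (G ⧸ M)]
    (μ : Measure (G ⧸ M)) [IsFiniteMeasureOnCompacts μ]
    {a : Z → G → F} {C : Set G} (hC : IsCompact C) (haC : ∀ z, ∀ g ∉ C, a z g = 0)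
    (p : G → P) (hp : Continuous p) (hpM : ∀ y, ∀ m ∈ M, p (y * m) = p y)
    (Ψ : P × (V × Z) → F) (hΨ : ContDiff ℝ ∞ Ψ) (hfac : ∀ z y x, a z (y * c x * y⁻¹) = Ψ (p y, (x, z))) :
    ContDiffOn ℝ ∞ (fun q : V × Z => ∫ u, descConj (c q.1) M (hcomm q.1) (a q.2) u ∂μ) (S ×ˢ univ) :=
  contDiffOn_integral_descConj_of_uniformlyProper_param_local M hcomm hS hprop μ isOpen_univ hC (fun z _ => haC z) p hp hpM Ψ hΨ hfac

/-- **(HYP-PARAM), everywhere-proper case**: (HYP) on all compacts of `V` ⇒ the quotient orbital integral of the smooth family is `C^∞` on `V × Z`.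
[cite: HormanderALPDO1, §1.1 Thm. 1.1.9 (p. 12)] [cite: DeitmarEchterhoff2014, Lemma 9.3.3] -/
theorem contDiff_integral_descConj_of_uniformlyProper_param
    (M : Subgroup G) {c : V → G} (hcomm : ∀ x, ∀ m ∈ M, m * c x = c x * m)
    (hprop : ∀ K : Set V, IsCompact K → ∀ C : Set G, IsCompact C →
      ∃ 𝒦 : Set (G ⧸ M), IsCompact 𝒦 ∧ ∀ x ∈ K, ∀ y : G, y * c x * y⁻¹ ∈ C → (QuotientGroup.mk y : G ⧸ M) ∈ 𝒦)
    [MeasurableSpace (G ⧸ M)] [OpensMeasurableSpace (G ⧸ M)] [T2Space (G ⧸ M)]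
    (μ : Measure (G ⧸ M)) [IsFiniteMeasureOnCompacts μ]
    {a : Z → G → F} {C : Set G} (hC : IsCompact C) (haC : ∀ z, ∀ g ∉ C, a z g = 0)
    (p : G → P) (hp : Continuous p) (hpM : ∀ y, ∀ m ∈ M, p (y * m) = p y)
    (Ψ : P × (V × Z) → F) (hΨ : ContDiff ℝ ∞ Ψ) (hfac : ∀ z y x, a z (y * c x * y⁻¹) = Ψ (p y, (x, z))) :
    ContDiff ℝ ∞ fun q : V × Z => ∫ u, descConj (c q.1) M (hcomm q.1) (a q.2) u ∂μ := by
  rw [← contDiffOn_univ, ← univ_prod_univ]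
  exact contDiffOn_integral_descConj_of_uniformlyProper_param M hcomm isOpen_univ (fun K _ hK C hC => hprop K hK C hC) μ hC haC p hp hpM Ψ hΨ hfac

/-- **The separately-stated parameter form most consumers quote**: smoothness in `z` alone at a fixed chart point `x ∈ S` (restrict (HYP-PARAM) along `z ↦ (x, z)`).
[cite: HormanderALPDO1, §1.1 Thm. 1.1.9 (p. 12)] -/
theorem contDiffOn_integral_descConj_param_of_uniformlyProper
    (M : Subgroup G) {c : V → G} (hcomm : ∀ x, ∀ m ∈ M, m * c x = c x * m)
    {S : Set V} (hS : IsOpen S)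
    (hprop : ∀ K ⊆ S, IsCompact K → ∀ C : Set G, IsCompact C →
      ∃ 𝒦 : Set (G ⧸ M), IsCompact 𝒦 ∧ ∀ x ∈ K, ∀ y : G, y * c x * y⁻¹ ∈ C → (QuotientGroup.mk y : G ⧸ M) ∈ 𝒦)
    [MeasurableSpace (G ⧸ M)] [OpensMeasurableSpace (G ⧸ M)] [T2Space (G ⧸ M)]
    (μ : Measure (G ⧸ M)) [IsFiniteMeasureOnCompacts μ]
    {T : Set Z} (hT : IsOpen T) {a : Z → G → F} {C : Set G} (hC : IsCompact C) (haC : ∀ z ∈ T, ∀ g ∉ C, a z g = 0)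
    (p : G → P) (hp : Continuous p) (hpM : ∀ y, ∀ m ∈ M, p (y * m) = p y)
    (Ψ : P × (V × Z) → F) (hΨ : ContDiff ℝ ∞ Ψ) (hfac : ∀ z y x, a z (y * c x * y⁻¹) = Ψ (p y, (x, z)))
    {x : V} (hx : x ∈ S) :
    ContDiffOn ℝ ∞ (fun z : Z => ∫ u, descConj (c x) M (hcomm x) (a z) u ∂μ) T := by
  have h := contDiffOn_integral_descConj_of_uniformlyProper_param_local M hcomm hS hprop μ hT hC haC p hp hpM Ψ hΨ hfac
  have hmaps : MapsTo (fun z : Z => (x, z)) T (S ×ˢ T) := fun z hz => ⟨hx, hz⟩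
  exact h.comp (contDiffOn_const.prodMk contDiffOn_id) hmaps

/-- Sanity rider: the non-parametric ★ engine is the constant-family case of (HYP-PARAM). [cite: HormanderALPDO1, §1.1 Thm. 1.1.9 (p. 12)] -/
theorem contDiffOn_integral_descConj_of_uniformlyProper_of_param
    (M : Subgroup G) {c : V → G} (hcomm : ∀ x, ∀ m ∈ M, m * c x = c x * m)
    {S : Set V} (hS : IsOpen S)
    (hprop : ∀ K ⊆ S, IsCompact K → ∀ C : Set G, IsCompact C →
      ∃ 𝒦 : Set (G ⧸ M), IsCompact 𝒦 ∧ ∀ x ∈ K, ∀ y : G, y * c x * y⁻¹ ∈ C → (QuotientGroup.mk y : G ⧸ M) ∈ 𝒦)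
    [MeasurableSpace (G ⧸ M)] [OpensMeasurableSpace (G ⧸ M)] [T2Space (G ⧸ M)]
    (μ : Measure (G ⧸ M)) [IsFiniteMeasureOnCompacts μ]
    {a : G → F} (hac : HasCompactSupport a)
    (p : G → P) (hp : Continuous p) (hpM : ∀ y, ∀ m ∈ M, p (y * m) = p y)
    (Ψ : P × V → F) (hΨ : ContDiff ℝ ∞ Ψ) (hfac : ∀ y x, a (y * c x * y⁻¹) = Ψ (p y, x)) :
    ContDiffOn ℝ ∞ (fun x => ∫ u, descConj (c x) M (hcomm x) a u ∂μ) S := by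
  have h := contDiffOn_integral_descConj_of_uniformlyProper_param (Z := ℝ) M hcomm hS hprop μ (a := fun _ : ℝ => a)
    hac.isCompact (fun _ g hg => image_eq_zero_of_notMem_tsupport hg) p hp hpM
    (fun r : P × (V × ℝ) => Ψ (r.1, r.2.1)) (hΨ.comp (contDiff_fst.prodMk (contDiff_fst.comp contDiff_snd))) (fun _ y x => hfac y x)
  have hmaps : MapsTo (fun x : V => (x, (0 : ℝ))) S (S ×ˢ univ) := fun x hx => ⟨hx, mem_univ _⟩
  exact h.comp (contDiffOn_id.prodMk contDiffOn_const) hmaps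

end SmoothParam

end Literature.MeasureTheory.Group

end
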